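import Summits.BirchSwinnertonDyer.Rank1Residual.X11b.BDPRouteHsiehFrame
import Summits.BirchSwinnertonDyer.Rank1Residual.X11b.LambdaSupplyPrime
import HarnessLib

/-!
# Class X11b, route p2 at `p ≥ 5` (and every odd `p`): conjunct 3.1♭ of the open input H∃♭ from
# HSIEH 2014 Thm. 1 ALONE — the λ-supply DISCHARGED at every odd prime; Hsieh's object EXISTS at every
# p2 datum; H∃♭ READ as a statement about that published object (cell `b2b-bsdres`, sub-cell
# `multr1-p2`, gen 25)

HONEST FRAMING (cell `b2b-bsdres`, run/shared/lean/b2b/bsd-rank1-residual/, verbatim in every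
file): the goal of the cell is to DELETE the COMBINATION-SHAPED residual classes of the
Birch–Swinnerton-Dyer formula for ALL analytic-rank `≤ 1` elliptic curves over `ℚ` — "full BSD
formula for every rank `≤ 1` curve in class `C`" assembled STRICTLY from published theorems — so
that the rank-`≤ 1` remainder becomes exactly the CONSTRUCTION-SHAPED classes, which are TYPED
(missing-input `Prop`s), NOT attempted. This is not "finishing BSD". Sub-cell `multr1-p2` is a
RESEARCH ROUTE on class X11b (`ClassX11b W p := r_an = 1 ∧ p ≠ 2 ∧ mult(p) ∧ irr(p)`,
`Partition/Rows.lean`); no claim beyond the stated class and loci; X11b's label does not change;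
NOTHING is booked by this file.

THEOREMS ONLY (no definition, no named fact, no `sorry`). The PUBLISHED named fact
`hsieh2014_exists_anticyclotomicPAdicLFunction` (Hsieh 2014 Thm. 1, typed by x11b3-lit1) is CONSUMED
as a hypothesis `hH`; nothing else is assumed in §§1–2.

## Why (gen 25, after `BDPRouteHsiehFrame.lean` and `LambdaSupplyPrime.lean`)

Gen 24 proved conjunct 3.1♭ of route p2's open input H∃♭ `P2.IMCDivIntFrameOnTree W p` (a BDP
element `Q ∈ 𝓞_{ℂ_p}⟦T⟧` with Castella's interpolation property at the datum) from Hsieh 2014 Thm. 1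
MODULO the λ-supply `hsup` — x11b3's S24-a statement at the prime `p` (an auxiliary anticyclotomic
Hecke character `λ` of `K`, unitary, type `(1,−1)`, trivial on `𝕀_ℚ`, unramified outside `p`, with
`p`-adic avatar through `κ`), without which Hsieh's typed fact cannot even be invoked (its `λ` is a
binder). x11b3 proved S24-a at `p = 3` (`Three.lambdaSupplyAt₃`, p264661); this sub-cell's gen 25
ported it to EVERY ODD PRIME (`X11b.lambdaSupplyAt`, `LambdaSupplyPrime.lean`). Hence:

* §1 **`P2.exists_isHsiehLFunction_of_hsieh2014`** — HSIEH'S OBJECT EXISTS AT EVERY p2 DATUM: for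
  `(E,p)` ∈ X11b (any odd `p`), `N = N_E`, `f` the newform, `K` imaginary quadratic with the
  classical Heegner hypothesis, anticyclotomic `(κ, γ)`, any `ι'`, `w₀`: `hH` ⟹ ∃ a Hsieh witness
  `(A > 0, Ω_K ≠ 0, C with ‖ι'⁻¹C‖ = 1, Ω_p with ‖Ω_p‖ = 1, Q ∈ 𝓞_{ℂ_p}⟦T⟧)` with
  `IsHsiehLFunction ι' 𝔭_{ι'} κ γ f A Ω_K C Ω_p Q`. NO λ hypothesis, NO semistability, NO `R₀`.
* §2 **`P2.exists_isBDPLFunctionInt_of_hsieh2014_supplied`** (+ `…_datum_…`): gen 24's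
  `P2.exists_isBDPLFunctionInt_of_hsieh2014_odd` with `hsup` DISCHARGED — conjunct 3.1♭ of H∃♭ holds
  at EVERY datum of route p2's open input from the PUBLISHED fact `hH` ALONE (every odd `p`; at
  `p ≥ 5` this is the route's range, at `p = 3` it serves team x11b3's ♭-typed readings if wanted).
* §3 **`P2.imcDivIntFrameOnTree_of_hsieh2014_of_forall_hsiehWitness`** — H∃♭ READ ON HSIEH'S OBJECT:
  `hH` + [at every datum, EVERY Hsieh witness `Q` carries the value at `𝟙` (`R1.BDPValueAtOneIntAt`)
  and the divisibility `Ch_Λ(X_ac)·𝓞_{ℂ_p}⟦T⟧ ⊆ (Q)`] ⟹ `P2.IMCDivIntFrameOnTree W p`. So what route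
  p2 asks of the literature beyond Hsieh's published construction is a ONE-SIDED statement (value at
  `𝟙` + (2.4)) about THAT object — Castella–Hsieh's `ℒ_p(f)` / Hsieh's `𝒫_Σ(π,λ)²` in the twisted
  variable —, in ∀-witness currency (no uniqueness claim needed); `P2.bsdp_of_locus_of_hsieh2014_…`
  records the A1 (Locus) consequence: PUB + cited + `hH` + that statement AT THE PAIR ⟹ `BSD(E,p)`.

HONEST READING for the registry (no fact filed, no mark): of H∃♭'s three conjuncts, 3.1♭ is now a
THEOREM from a PUBLISHED fact (Hsieh 2014 Thm. 1) on ALL 2 267 348 X11b-shape pairs at `p ≥ 5` (and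
on the X11b@3 shape in ♭ currency) — no hypothesis left; 3.2♭ stays PUBLISHED on the semistable
pairs (Cas18 Thm. 3.2) / PREPRINT elsewhere; (2.4)♭ PREPRINT everywhere. In ∃∧-currency the three are
demanded of ONE `Q`; §3 pins that `Q` to Hsieh's witnesses. CONDITIONAL; nothing booked; labels
UNCHANGED; X11b stays CONSTRUCTION-SHAPED.

References: [Hsieh2014] M.-L. Hsieh, Doc. Math. 19 (2014) 709–767, Thm. 1 (arXiv:1112.1580 pp. 3–4);
[Castella2018] Thm. 3.1, Thm. 3.2 (arXiv:1704.06608 p. 9); [Castella2018Erratum] (2.4);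
[CastellaHsieh2018] §3.3; [Weil1956] §1–§2; [Greenberg1987] §2.
-/

noncomputable section

open scoped Classical NumberField

open WeierstrassCurve NumberField IsDedekindDomain Field PowerSeries
open Literature.NumberTheory.EllipticCurves Literature.NumberTheory.EllipticCurves.GreenbergSelmer
open Literature.NumberTheory.EllipticCurves.ModularForms
open Literature.NumberTheory.EllipticCurves.Rank1Residual
open Literature.NumberTheory.EllipticCurves.Rank1Residual.Typed
open Literature.NumberTheory.EllipticCurves.Castella2018
open Literature.NumberTheory.EllipticCurves.Wuthrich2014
open Literature.NumberTheory.EllipticCurves.Skinner2016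
open Literature.NumberTheory.QuadraticFields.Quadratic
open Literature.NumberTheory.GaloisRepresentations Literature.NumberTheory.GaloisCohomology
open Literature.NumberTheory.Automorphic
open Summit.BirchSwinnertonDyer.Rank1Residual.X11b.AcSelmer
open Summit.BirchSwinnertonDyer.Rank1Residual.X11b.Halves

namespace Summit.BirchSwinnertonDyer.Rank1Residual.X11b

/-! ### §1 Hsieh's object exists at every p2 datum (no λ hypothesis) -/

section HsiehWitness

variable (W : WeierstrassCurve ℚ) [W.IsElliptic] (p : ℕ) [Fact p.Prime]

/-- **HSIEH'S ANTICYCLOTOMIC `p`-ADIC `L`-FUNCTION EXISTS AT EVERY p2 DATUM** (any odd `p`): for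
`(E,p)` in X11b, `N = N_E`, `f` the newform of `E`, `K` imaginary quadratic with the classical Heegner
hypothesis for `N`, an anticyclotomic `ℤ_p`-extension `κ` with topological generator `γ`, an embedding
datum `ι'` and an infinite place `w₀`: Hsieh 2014 Thm. 1 gives a witness `(A, Ω_K, C, Ω_p, Q)` —
`0 < A`, `Ω_K ≠ 0`, `‖ι'⁻¹C‖ = 1`, `‖Ω_p‖ = 1`, `IsHsiehLFunction ι' 𝔭_{ι'} κ γ f A Ω_K C Ω_p Q`.
Hsieh's hypotheses from the datum: `p ≠ 2` (`ClassX11b`); `IsNewform0 f`; `p² ∤ N`, `p ∣ N`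
(multiplicative); `p` split (the Heegner hypothesis at `p ∣ N`); `p ∈ 𝔭_{ι'}` and the compatibility
clause (`EmbeddingDatumPrime.lean`); the auxiliary `λ` from `X11b.lambdaSupplyAt` (every odd prime).
CONDITIONAL on the published fact `hH` only; nothing booked.
[cite: Hsieh2014, Thm. 1 (arXiv:1112.1580 pp. 3–4)] [cite: Weil1956, §1–§2] -/
theorem P2.exists_isHsiehLFunction_of_hsieh2014
    (hH : hsieh2014_exists_anticyclotomicPAdicLFunction) {N : ℕ} [NeZero N] {K : Type} [Field K]
    [NumberField K] {f : CuspForm (CongruenceSubgroup.Gamma0 N) 2} (hnf : IsNewformOf W f)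
    (hX : ClassX11b W p) (hN : W.conductorNorm ℤ = N) (hK : IsImaginaryQuadratic K)
    (hHN : SatisfiesHeegnerHypothesis N K) (κ : ZpExtension K p) (hκ : κ.IsAnticyclotomic)
    (γ : Field.absoluteGaloisGroup K) [hγ : Fact (κ.IsTopGenerator γ)] (ι' : PadicAlgCl p ≃+* ℂ)
    (w₀ : InfinitePlace K) :
    ∃ (A : ℝ) (ΩK C : ℂ) (Ωp : ℂ_[p]) (Q : PowerSeries 𝓞_ℂ_[p]),
      0 < A ∧ ΩK ≠ 0 ∧ ‖((ι'.symm C : PadicAlgCl p) : ℂ_[p])‖ = 1 ∧ ‖Ωp‖ = 1 ∧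
        IsHsiehLFunction ι' (primeOfEmbeddingDatum p ι' w₀.embedding) κ γ f A ΩK C Ωp Q := by
  obtain ⟨lam, rlam, hunit, hinfl, hAQ, hunrl, havl, hfacl⟩ := lambdaSupplyAt hX.2.1 ι' K κ hK hκ
  have hp : p.Prime := Fact.out
  have hmult : Mult W p := hX.2.2.1
  have h9 : ¬ p ^ 2 ∣ N := hN ▸ not_sq_dvd_conductorNorm_of_mult W p hmult
  have hpN : p ∣ N := hN ▸ dvd_conductorNorm_of_mult hmult
  exact hH ι' K (primeOfEmbeddingDatum p ι' w₀.embedding) κ γ f lam rlam hX.2.1 hnf.1 h9 hK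
    (hHN p hp hpN) (natCast_mem_primeOfEmbeddingDatum p ι' w₀.embedding)
    (forall_mem_primeOfEmbeddingDatum_iff p ι' hK w₀) hHN hunit hinfl hAQ hunrl havl hfacl hκ hγ.out

end HsiehWitness

/-! ### §2 Conjunct 3.1♭ of H∃♭ at every datum from Hsieh 2014 Thm. 1 ALONE -/

section Supplied

variable (W : WeierstrassCurve ℚ) [W.IsElliptic] (p : ℕ) [Fact p.Prime]

/-- **Cas18 Thm. 3.1♭ AT EVERY p2 DATUM from HSIEH 2014 Thm. 1 ALONE — the λ-supply DISCHARGED**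
(gen 24's `P2.exists_isBDPLFunctionInt_of_hsieh2014_odd` with `hsup := X11b.lambdaSupplyAt …`): for
`(E,p)` in X11b (any odd `p`), `N = N_E`, `f` the newform, `K` imaginary quadratic with the classical
Heegner hypothesis, anticyclotomic `(κ, γ)`, any `ι'`, `w₀`: THERE IS a ♭-frame
`(Ω_K ≠ 0, Ω_p with ‖Ω_p‖ = 1, Q ∈ 𝓞_{ℂ_p}⟦T⟧)` with Castella's interpolation property
`R1.IsBDPLFunctionInt p ι' 𝔭_{ι'} κ γ f Ω_K Ω_p Q` — conjunct 3.1♭ of `P2.IMCDivIntFrameOnTree W p`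
at the datum, semistable OR NOT, with NO hypothesis beyond the published fact `hH`. Nothing booked.
[cite: Hsieh2014, Thm. 1 (arXiv:1112.1580 pp. 3–4)] [cite: Castella2018, Thm. 3.1 (arXiv:1704.06608 p. 9)] -/
theorem P2.exists_isBDPLFunctionInt_of_hsieh2014_supplied
    (hH : hsieh2014_exists_anticyclotomicPAdicLFunction) {N : ℕ} [NeZero N] {K : Type} [Field K]
    [NumberField K] {f : CuspForm (CongruenceSubgroup.Gamma0 N) 2} (hnf : IsNewformOf W f)
    (hX : ClassX11b W p) (hN : W.conductorNorm ℤ = N) (hK : IsImaginaryQuadratic K)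
    (hHN : SatisfiesHeegnerHypothesis N K) (κ : ZpExtension K p) (hκ : κ.IsAnticyclotomic)
    (γ : Field.absoluteGaloisGroup K) [Fact (κ.IsTopGenerator γ)] (ι' : PadicAlgCl p ≃+* ℂ)
    (w₀ : InfinitePlace K) :
    ∃ (ΩK : ℂ) (Ωp : ℂ_[p]) (Q : PowerSeries 𝓞_ℂ_[p]), ΩK ≠ 0 ∧ ‖Ωp‖ = 1 ∧
      R1.IsBDPLFunctionInt p ι' (primeOfEmbeddingDatum p ι' w₀.embedding) κ γ f ΩK Ωp Q :=
  P2.exists_isBDPLFunctionInt_of_hsieh2014_odd W p hH hnf hX hN hK hHN κ hκ γ ι' w₀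
    (lambdaSupplyAt hX.2.1 ι' K κ hK hκ)

/-- **The same at the data of `P2.IMCDivIntFrameOnTree W p` literally** (with `f = Dt.f`): conjunct
3.1♭ of H∃♭ is SATISFIED at every datum of route p2's open input from Hsieh 2014 Thm. 1 alone — route
p2 does not ask, on any pair, for an object without a published construction, and no auxiliary
hypothesis is left in that statement. CONDITIONAL on `hH` only; nothing booked.
[cite: Hsieh2014, Thm. 1 (arXiv:1112.1580 pp. 3–4)] [cite: Castella2018, Thm. 3.1 (arXiv:1704.06608 p. 9)] -/
theorem P2.exists_isBDPLFunctionInt_datum_of_hsieh2014_supplied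
    (hH : hsieh2014_exists_anticyclotomicPAdicLFunction) {N : ℕ} [NeZero N] {K : Type} [Field K]
    [NumberField K] (Dt : ModularParametrizationData W N) (hX : ClassX11b W p)
    (hN : W.conductorNorm ℤ = N) (hK : IsImaginaryQuadratic K) (hHN : SatisfiesHeegnerHypothesis N K)
    (κ : ZpExtension K p) (hκ : κ.IsAnticyclotomic) (γ : Field.absoluteGaloisGroup K)
    [Fact (κ.IsTopGenerator γ)] (ι' : PadicAlgCl p ≃+* ℂ) (w₀ : InfinitePlace K) :
    ∃ (ΩK : ℂ) (Ωp : ℂ_[p]) (Q : PowerSeries 𝓞_ℂ_[p]), ΩK ≠ 0 ∧ ‖Ωp‖ = 1 ∧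
      R1.IsBDPLFunctionInt p ι' (primeOfEmbeddingDatum p ι' w₀.embedding) κ γ Dt.f ΩK Ωp Q :=
  P2.exists_isBDPLFunctionInt_of_hsieh2014_supplied W p hH Dt.isNewformOf hX hN hK hHN κ hκ γ ι' w₀

end Supplied

/-! ### §3 H∃♭ read on Hsieh's object: `hH` + a ∀-witness statement ⟹ H∃♭ -/

section ReadOnHsieh

variable {W : WeierstrassCurve ℚ} [W.IsElliptic] [W.IsGloballyMinimal] {p : ℕ} [Fact p.Prime]

/-- **H∃♭ READ ON HSIEH'S PUBLISHED OBJECT.** If at every datum of `P2.IMCDivIntFrameOnTree W p`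
EVERY Hsieh witness `(A, Ω_K, C, Ω_p, Q)` (`0 < A`, `Ω_K ≠ 0`, `‖ι'⁻¹C‖ = 1`, `‖Ω_p‖ = 1`,
`IsHsiehLFunction ι' 𝔭_{ι'} κ γ f_{Dt} A Ω_K C Ω_p Q`) carries the value at `𝟙`
(`R1.BDPValueAtOneIntAt W p e P' Q a_p`) and the divisibility `Ch_Λ(X_ac^∅(E[p^∞]))·𝓞_{ℂ_p}⟦T⟧ ⊆ (Q)`,
then H∃♭ holds — because a witness EXISTS at the datum (§1, Hsieh 2014 Thm. 1 + the λ-supply at every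
odd prime) and gen 24's glue (`P2.imcDivIntFrameOnTree_of_hsiehFrame`) re-normalises it. So route p2's
open input is, beyond Hsieh's published construction, a ONE-SIDED statement about THAT object
(value at `𝟙` + erratum (2.4)) in ∀-witness currency. CONDITIONAL on `hH` and the ∀-witness
statement (open: [CastellaHsieh2018 §3.3] / [Castella2018Erratum (2.4)] / [Castella 2024]); nothing
booked. [cite: Hsieh2014, Thm. 1 (arXiv:1112.1580 pp. 3–4)]
[cite: Castella2018, Thms. 3.1–3.2 (arXiv:1704.06608 p. 9)] [cite: Castella2018Erratum, (2.4) (p. 4)] -/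
theorem P2.imcDivIntFrameOnTree_of_hsieh2014_of_forall_hsiehWitness
    (hH : hsieh2014_exists_anticyclotomicPAdicLFunction)
    (hVD : ∀ (N : ℕ) [NeZero N] (K : Type) [Field K] [NumberField K]
      (Dt : ModularParametrizationData W N) (H : HeegnerDatum N (NumberField.discr K)) (ι : K →+* ℂ)
      (P : (W.baseChange K).toAffine.Point),
      ClassX11b W p → 5 ≤ p → Surj W p → W.conductorNorm ℤ = N → IsImaginaryQuadratic K →
      Odd (NumberField.discr K) → ¬ (p : ℤ) ∣ NumberField.discr K → ¬ p ∣ Units.torsionOrder K →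
      SatisfiesHeegnerHypothesis N K →
      (W.quadraticTwist (NumberField.discr K : ℚ)).entireLFunction 1 ≠ 0 →
      WeierstrassCurve.Affine.Point.map ι.toRatAlgHom P = heegnerPointComplex Dt H →
      ¬ (p : ℤ) ∣ Dt.c → ¬ IsOfFinAddOrder P →
      ∀ (κ : ZpExtension K p), κ.IsAnticyclotomic →
        ∀ (γ : Field.absoluteGaloisGroup K) [Fact (κ.IsTopGenerator γ)]
          (ι' : PadicAlgCl p ≃+* ℂ) (w₀ : InfinitePlace K) (P' : (W.baseChange K).toAffine.Point),
          WeierstrassCurve.Affine.Point.map w₀.embedding.toRatAlgHom P' = heegnerPointComplex Dt H →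
          ∀ (e : K →+* ℚ_[p]),
            (∀ k : 𝓞 K, k ∈ (primeOfEmbeddingDatum p ι' w₀.embedding).asIdeal ↔ ‖e (k : K)‖ < 1) →
            ∀ (A : ℝ) (ΩK C : ℂ) (Ωp : ℂ_[p]) (Q : PowerSeries 𝓞_ℂ_[p]),
              0 < A → ΩK ≠ 0 → ‖((ι'.symm C : PadicAlgCl p) : ℂ_[p])‖ = 1 → ‖Ωp‖ = 1 →
              IsHsiehLFunction ι' (primeOfEmbeddingDatum p ι' w₀.embedding) κ γ Dt.f A ΩK C Ωp Q →
              R1.BDPValueAtOneIntAt W p e P' Q (W.LFunction p) ∧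
              (XAc.charIdeal (W.baseChange K) p κ (primeOfEmbeddingDatum p ι' w₀.embedding) ∅ γ).map
                (PowerSeries.map (R1.toCpInt p)) ≤ Ideal.span {Q}) :
    P2.IMCDivIntFrameOnTree W p := by
  refine P2.imcDivIntFrameOnTree_of_hsiehFrame fun N _ K _ _ Dt H ιK P hX h5 hs hN hK hodd hpd hμ
      hHN hLt hP hc hPinf κ hκ γ _ ι' w₀ P' hP' e he => ?_
  obtain ⟨A, ΩK, C, Ωp, Q, hA, hΩK, hC, hΩp, hQ⟩ :=
    P2.exists_isHsiehLFunction_of_hsieh2014 W p hH Dt.isNewformOf hX hN hK hHN κ hκ γ ι' w₀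
  obtain ⟨hval, hdiv⟩ := hVD N K Dt H ιK P hX h5 hs hN hK hodd hpd hμ hHN hLt hP hc hPinf κ hκ γ ι'
    w₀ P' hP' e he A ΩK C Ωp Q hA hΩK hC hΩp hQ
  exact ⟨A, ΩK, C, Ωp, Q, hA, hΩK, hC, hΩp, hQ, hval, hdiv⟩

/-- **A1 — ANY Locus pair (2 093 111 ‖ 61 629): `BSD(E,p)` from published + cited facts, Hsieh 2014
Thm. 1, and the ∀-witness statement of `P2.imcDivIntFrameOnTree_of_hsieh2014_of_forall_hsiehWitness`
— NOTHING per pair, no `R₀`, no λ hypothesis.** Gen 24's `P2.bsdp_of_locus_of_imcDivIntFrame` with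
H∃♭ assembled on Hsieh's object. CONDITIONAL on `hH` (published) and the ∀-witness statement (open);
nothing booked. [cite: Hsieh2014, Thm. 1 (arXiv:1112.1580 pp. 3–4)]
[cite: Castella2018Erratum, (2.4), Thm. 1.1 (pp. 1, 4)] [cite: Castella2018, Thms. 3.1–3.2, §5]
[cite: Skinner2016PacificMC, Thm. C (§1)] [cite: McCallumLMS1991, §1 Theorem (Kolyvagin), p. 296] -/
theorem P2.bsdp_of_locus_of_hsieh2014_of_forall_hsiehWitness
    (hGZ : ∀ (N : ℕ) [NeZero N] (W : WeierstrassCurve ℚ) (K : Type) [Field K] [NumberField K],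
      gross_zagier N W K)
    (hKo : ∀ (N : ℕ) [NeZero N] (W : WeierstrassCurve ℚ) (K : Type) [Field K] [NumberField K],
      kolyvagin N W K)
    (hB : ∀ (N : ℕ) [NeZero N] (W : WeierstrassCurve ℚ) (K : Type) [Field K] [NumberField K],
      Kolyvagin1990_padicValNat_card_sha_le N W K)
    (hSk : Skinner2016.thmC_padicValRat_bsd_rank_zero) (hWu : sha_dvd_analyticSha)
    (hGZK : rank_eq_analyticRank_of_analyticRank_le_one) (hnf : exists_isNewformOf)
    (hHL : HoffsteinLuo1997_exists_twist_L_one_ne_zero) (hMaz : mazur_not_dvd_maninConstant_of_odd)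
    (hPT : ∀ (K : Type) [Field K] [NumberField K], poitouTate_sum_localTatePairing_eq_zero K)
    (hEP : ∀ (K : Type) [Field K] [NumberField K] (v : HeightOneSpectrum (𝓞 K)),
      localEulerPoincareCharacteristic (v.adicCompletion K))
    (hH : hsieh2014_exists_anticyclotomicPAdicLFunction)
    (hVD : ∀ (N : ℕ) [NeZero N] (K : Type) [Field K] [NumberField K]
      (Dt : ModularParametrizationData W N) (H : HeegnerDatum N (NumberField.discr K)) (ι : K →+* ℂ)
      (P : (W.baseChange K).toAffine.Point),
      ClassX11b W p → 5 ≤ p → Surj W p → W.conductorNorm ℤ = N → IsImaginaryQuadratic K →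
      Odd (NumberField.discr K) → ¬ (p : ℤ) ∣ NumberField.discr K → ¬ p ∣ Units.torsionOrder K →
      SatisfiesHeegnerHypothesis N K →
      (W.quadraticTwist (NumberField.discr K : ℚ)).entireLFunction 1 ≠ 0 →
      WeierstrassCurve.Affine.Point.map ι.toRatAlgHom P = heegnerPointComplex Dt H →
      ¬ (p : ℤ) ∣ Dt.c → ¬ IsOfFinAddOrder P →
      ∀ (κ : ZpExtension K p), κ.IsAnticyclotomic →
        ∀ (γ : Field.absoluteGaloisGroup K) [Fact (κ.IsTopGenerator γ)]
          (ι' : PadicAlgCl p ≃+* ℂ) (w₀ : InfinitePlace K) (P' : (W.baseChange K).toAffine.Point),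
          WeierstrassCurve.Affine.Point.map w₀.embedding.toRatAlgHom P' = heegnerPointComplex Dt H →
          ∀ (e : K →+* ℚ_[p]),
            (∀ k : 𝓞 K, k ∈ (primeOfEmbeddingDatum p ι' w₀.embedding).asIdeal ↔ ‖e (k : K)‖ < 1) →
            ∀ (A : ℝ) (ΩK C : ℂ) (Ωp : ℂ_[p]) (Q : PowerSeries 𝓞_ℂ_[p]),
              0 < A → ΩK ≠ 0 → ‖((ι'.symm C : PadicAlgCl p) : ℂ_[p])‖ = 1 → ‖Ωp‖ = 1 →
              IsHsiehLFunction ι' (primeOfEmbeddingDatum p ι' w₀.embedding) κ γ Dt.f A ΩK C Ωp Q →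
              R1.BDPValueAtOneIntAt W p e P' Q (W.LFunction p) ∧
              (XAc.charIdeal (W.baseChange K) p κ (primeOfEmbeddingDatum p ι' w₀.embedding) ∅ γ).map
                (PowerSeries.map (R1.toCpInt p)) ≤ Ideal.span {Q})
    (hX : ClassX11b W p) (hp5 : 5 ≤ p) (hram : Ram W p) (htam : ¬ p ∣ W.tamagawaProduct) :
    BSDp W p :=
  P2.bsdp_of_locus_of_imcDivIntFrame hGZ hKo hB hSk hWu hGZK hnf hHL hMaz hPT hEP
    (P2.imcDivIntFrameOnTree_of_hsieh2014_of_forall_hsiehWitness hH hVD) hX hp5 hram htam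

end ReadOnHsieh

end Summit.BirchSwinnertonDyer.Rank1Residual.X11b

end
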